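import Summits.NavierStokesRegularity.FluidComputer.GeometricFace
import Summits.NavierStokesRegularity.FluidComputer.SummedOccupationFloor
import HarnessLib

/-!
# Fluid computer — the level dictionary: the SUMMED LEVEL-OCCUPATION floors with the BKM-class hypothesis
# DISCHARGED (ν > 0)

HONEST FRAMING (cell `pub-fluidc`, verbatim): *low prior, high value-of-information experiment on Tao's
machine paradigm; NOT a claim that NS blows up.* Theorem side of the cell; nothing here is evidence of blow-up.
`SummedOccupationFloor` (gen 6) reads Beale–Kato–Majda level by level — `Σ_j 2^j ∫_{(t₀,T)} ‖Δ̇_j u(t)‖_∞ dt = ∞`,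
every tail above every level diverges, no summable gauge dominates the level occupations — for classical solutions
IN THE BKM CLASS on every closed sub-slab (all `L²` Sobolev norms bounded), a hypothesis the dictionary's class
(maximal smooth + Leray–Hopf from an `L²` datum) does not meet at `t = 0`. `GeometricFace.hasBoundedSobolevNormsOn_translate`
(this gen) puts every INTERIOR translate `u(· + s)` in that class; this module removes the hypothesis for `ν > 0`.
For every maximal smooth solution `(u, p)` of the unforced Navier–Stokes system on `ℝ³ × [0, T)` (`ν > 0`) which is
Leray–Hopf from `u 0`, and every `t₀ ∈ [0, T)`:

* `tsum_occupation_eq_top` — `Σ_{j∈ℤ} 2^j ∫_{(t₀,T)} ‖Δ̇_j u(t)‖_{L^∞} dt = ∞` (summed amplitude-weighted residence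
  `Σ_n k_n ∫U_n dt` over the levels, inside every terminal window);
* `tail_and_gauge` — for every `J ∈ ℕ`, `Σ_{q≥0} 2^{J+q} ∫_{(t₀,T)} ‖Δ̇_{J+q} u‖_∞ = ∞` (delivered UPWARD, above every
  level), and for every summable gauge `b` (`Σ_q b_q < ∞`), `b_q < 2^q ∫_{(t₀,T)} ‖Δ̇_q u‖_∞` at INFINITELY MANY `q`;
* `frequently_lt_peak_occupation` — the atlas's occupation companion `O = k · U_pk · τ` beats every summable gauge at
  infinitely many levels in every terminal window: `b_q < 2^q · sup_{(t₀,T)} ‖Δ̇_q u‖_∞ · (T − t₀)` i.o.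

Proof: the conditional theorems applied to the translate at `s = (t₀ + T)/2` (maximal, in the BKM class on closed
sub-slabs), and `∫_{(0,T−s)} G(τ + s) dτ = ∫_{(s,T)} G ≤ ∫_{(t₀,T)} G` (`setLIntegral_translate_le`). Necessity only;
in FORM checkable against a DNS level table (occupations `k_q U_q τ_q`), constants absent (divergence statements).
0 sorry; no new definitions, no named facts.

## References

* J. T. Beale, T. Kato, A. Majda, Comm. Math. Phys. 94 (1984) 61–66, Thm. 1. [BealeKatoMajda1984]
* H. Bahouri, J.-Y. Chemin, R. Danchin, *Fourier Analysis and Nonlinear PDE*, Springer 2011, Lemma 2.1.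
  [BahouriCheminDanchin2011]
* T. Tao, Anal. PDE 6 (2013) 25–107, Cor. 11.1. [Tao2011]
-/

noncomputable section

open MeasureTheory Set Function Filter Topology
open scoped ENNReal NNReal
open Literature.Analysis.FluidPDE Literature.Analysis.FunctionSpaces
open Summit.NavierStokesRegularity.FluidComputer.GeometricFace

namespace Summit.NavierStokesRegularity.FluidComputer.OccupationDischarge

/-- **Window integrals of a translate sit inside the larger window**: for `t₀ ≤ s` and any `G : ℝ → [0, ∞]`,
`∫_{(0, T−s)} G(τ + s) dτ = ∫_{(s, T)} G ≤ ∫_{(t₀, T)} G` (translation invariance, `lintegral_Ioo_comp_add_right`,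
and monotonicity in the set). [folklore] -/
theorem setLIntegral_translate_le {t₀ s T : ℝ} (hs : t₀ ≤ s) (G : ℝ → ℝ≥0∞) :
    ∫⁻ τ in Ioo 0 (T - s), G (τ + s) ≤ ∫⁻ t in Ioo t₀ T, G t := by
  rw [lintegral_Ioo_comp_add_right G s (T - s), add_sub_cancel]
  exact lintegral_mono_set (Ioo_subset_Ioo_left hs)

/-- **THE SUMMED LEVEL-OCCUPATION DIVERGES IN EVERY TERMINAL WINDOW — no class hypothesis** (`ν > 0`). Along every
maximal smooth Leray–Hopf solution of the unforced Navier–Stokes system on `ℝ³ × [0, T)`, for every `t₀ ∈ [0, T)`: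
`∑_{j∈ℤ} 2^j ∫⁻_{(t₀,T)} ‖Δ̇_j u(t)‖_{L^∞} dt = ∞`. (`SummedOccupationFloor.tsum_occupation_eq_top_of_maximal` for the
translate at `s = (t₀ + T)/2`, which is in the BKM class on closed sub-slabs by
`GeometricFace.hasBoundedSobolevNormsOn_translate`; then `setLIntegral_translate_le` term by term.)
[cite: BealeKatoMajda1984, Theorem 1] [cite: BahouriCheminDanchin2011, Lemma 2.1] -/
theorem tsum_occupation_eq_top {ν T : ℝ} (hν : 0 < ν) (hT : 0 < T)
    {u : ℝ → EuclideanSpace ℝ (Fin 3) → EuclideanSpace ℝ (Fin 3)} {p : ℝ → EuclideanSpace ℝ (Fin 3) → ℝ}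
    (hmax : IsMaximalSmoothSolution ν 0 u p T) (hLH : IsLerayHopfOn T ν 0 (u 0) u)
    {t₀ : ℝ} (ht₀ : t₀ ∈ Ico 0 T) :
    ∑' j : ℤ, (2 : ℝ≥0∞) ^ j * ∫⁻ t in Ioo t₀ T, eLpNorm (blockFn j (u t)) ∞ volume = ∞ := by
  set s : ℝ := (t₀ + T) / 2 with hsdef
  have hs : s ∈ Ioo 0 T := ⟨by rw [hsdef]; linarith [ht₀.1, ht₀.2], by rw [hsdef]; linarith [ht₀.2]⟩
  have ht₀s : t₀ ≤ s := by rw [hsdef]; linarith [ht₀.2]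
  have hTs : 0 < T - s := sub_pos.2 hs.2
  have hmaxs := hmax.translate_zero hs.1 hs.2
  have hreg : ∀ T'' < T - s, HasBoundedSobolevNormsOn (Icc 0 T'') (fun t => u (t + s)) :=
    fun T'' hT'' => hasBoundedSobolevNormsOn_translate hν hT hmax hLH hs hT''
  have h := SummedOccupationFloor.tsum_occupation_eq_top_of_maximal hν.le hTs hmaxs hreg (t₀ := 0) ⟨le_rfl, hTs⟩
  refine eq_top_iff.2 (h.symm.le.trans (ENNReal.tsum_le_tsum fun j => mul_le_mul' le_rfl ?_))
  exact setLIntegral_translate_le ht₀s (fun t => eLpNorm (blockFn j (u t)) ∞ volume)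

/-- **EVERY TAIL DIVERGES, AND NO SUMMABLE GAUGE DOMINATES THE LEVEL OCCUPATIONS — no class hypothesis**
(`ν > 0`). Along every maximal smooth Leray–Hopf solution of the unforced system on `ℝ³ × [0, T)`, for every
`t₀ ∈ [0, T)`: for every `J ∈ ℕ`, `∑_{q≥0} 2^{J+q} ∫⁻_{(t₀,T)} ‖Δ̇_{J+q} u(t)‖_∞ dt = ∞` (the occupation is delivered
above every level, inside every terminal window); and for every `b : ℕ → [0,∞]` with `Σ_q b_q < ∞`,
`b_q < 2^q ∫⁻_{(t₀,T)} ‖Δ̇_q u(t)‖_∞ dt` at infinitely many `q`. (`SummedOccupationFloor.tail_and_gauge_of_maximal` for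
the translate, carried back by `setLIntegral_translate_le`.) [cite: BealeKatoMajda1984, Theorem 1]
[cite: BahouriCheminDanchin2011, Lemma 2.1] -/
theorem tail_and_gauge {ν T : ℝ} (hν : 0 < ν) (hT : 0 < T)
    {u : ℝ → EuclideanSpace ℝ (Fin 3) → EuclideanSpace ℝ (Fin 3)} {p : ℝ → EuclideanSpace ℝ (Fin 3) → ℝ}
    (hmax : IsMaximalSmoothSolution ν 0 u p T) (hLH : IsLerayHopfOn T ν 0 (u 0) u)
    {t₀ : ℝ} (ht₀ : t₀ ∈ Ico 0 T) :
    (∀ J : ℕ, ∑' q : ℕ, (2 : ℝ≥0∞) ^ (J + q) *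
        ∫⁻ t in Ioo t₀ T, eLpNorm (blockFn ((J + q : ℕ) : ℤ) (u t)) ∞ volume = ∞) ∧
    ∀ b : ℕ → ℝ≥0∞, ∑' q, b q ≠ ∞ →
      ∃ᶠ q : ℕ in atTop, b q < (2 : ℝ≥0∞) ^ q * ∫⁻ t in Ioo t₀ T, eLpNorm (blockFn (q : ℤ) (u t)) ∞ volume := by
  set s : ℝ := (t₀ + T) / 2 with hsdef
  have hs : s ∈ Ioo 0 T := ⟨by rw [hsdef]; linarith [ht₀.1, ht₀.2], by rw [hsdef]; linarith [ht₀.2]⟩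
  have ht₀s : t₀ ≤ s := by rw [hsdef]; linarith [ht₀.2]
  have hTs : 0 < T - s := sub_pos.2 hs.2
  have hmaxs := hmax.translate_zero hs.1 hs.2
  have hreg : ∀ T'' < T - s, HasBoundedSobolevNormsOn (Icc 0 T'') (fun t => u (t + s)) :=
    fun T'' hT'' => hasBoundedSobolevNormsOn_translate hν hT hmax hLH hs hT''
  obtain ⟨htail, hgauge⟩ :=
    SummedOccupationFloor.tail_and_gauge_of_maximal hν.le hTs hmaxs hreg (t₀ := 0) ⟨le_rfl, hTs⟩
  refine ⟨fun J => ?_, fun b hb => ?_⟩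
  · refine eq_top_iff.2 ((htail J).symm.le.trans (ENNReal.tsum_le_tsum fun q => mul_le_mul' le_rfl ?_))
    exact setLIntegral_translate_le ht₀s (fun t => eLpNorm (blockFn ((J + q : ℕ) : ℤ) (u t)) ∞ volume)
  · refine (hgauge b hb).mono fun q hq => hq.trans_le (mul_le_mul' le_rfl ?_)
    exact setLIntegral_translate_le ht₀s (fun t => eLpNorm (blockFn (q : ℤ) (u t)) ∞ volume)

/-- **The atlas's occupation companion beats every summable gauge — no class hypothesis** (`ν > 0`; RULING R35 F6
shape `O = k · U_pk · τ`). Along every maximal smooth Leray–Hopf solution of the unforced system, for every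
`t₀ ∈ [0, T)` and every `b : ℕ → [0,∞]` with `Σ_q b_q < ∞`:
`b_q < 2^q · (sup_{t ∈ (t₀,T)} ‖Δ̇_q u(t)‖_∞) · (T − t₀)` at infinitely many levels `q` (from `tail_and_gauge` and
`∫_{(t₀,T)} U_q ≤ U_{q,pk} (T − t₀)`). [cite: BealeKatoMajda1984, Theorem 1] -/
theorem frequently_lt_peak_occupation {ν T : ℝ} (hν : 0 < ν) (hT : 0 < T)
    {u : ℝ → EuclideanSpace ℝ (Fin 3) → EuclideanSpace ℝ (Fin 3)} {p : ℝ → EuclideanSpace ℝ (Fin 3) → ℝ}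
    (hmax : IsMaximalSmoothSolution ν 0 u p T) (hLH : IsLerayHopfOn T ν 0 (u 0) u)
    {t₀ : ℝ} (ht₀ : t₀ ∈ Ico 0 T) {b : ℕ → ℝ≥0∞} (hb : ∑' q, b q ≠ ∞) :
    ∃ᶠ q : ℕ in atTop, b q < (2 : ℝ≥0∞) ^ q *
      (⨆ t ∈ Ioo t₀ T, eLpNorm (blockFn (q : ℤ) (u t)) ∞ volume) * ENNReal.ofReal (T - t₀) := by
  refine ((tail_and_gauge hν hT hmax hLH ht₀).2 b hb).mono fun q hq => hq.trans_le ?_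
  rw [mul_assoc]
  gcongr
  calc (∫⁻ t in Ioo t₀ T, eLpNorm (blockFn (q : ℤ) (u t)) ∞ volume)
      ≤ ∫⁻ _ in Ioo t₀ T, ⨆ s ∈ Ioo t₀ T, eLpNorm (blockFn (q : ℤ) (u s)) ∞ volume :=
        setLIntegral_mono' measurableSet_Ioo fun t ht =>
          le_iSup₂ (f := fun s (_ : s ∈ Ioo t₀ T) => eLpNorm (blockFn (q : ℤ) (u s)) ∞ volume) t ht
    _ = (⨆ s ∈ Ioo t₀ T, eLpNorm (blockFn (q : ℤ) (u s)) ∞ volume) * ENNReal.ofReal (T - t₀) := by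
        rw [setLIntegral_const, Real.volume_Ioo]

end Summit.NavierStokesRegularity.FluidComputer.OccupationDischarge

end
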